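import Literature.Analysis.PDE.EvansKrylovJets
import Literature.Analysis.PDE.EvansKrylovOscillation
import Literature.Analysis.PDE.MotzkinWasow
import Mathlib.Analysis.Calculus.FDeriv.Measurable
import Mathlib.Analysis.Calculus.FDeriv.Symmetric
import Mathlib.Algebra.Order.Chebyshev
import HarnessLib

/-!
# Evans–Krylov interior estimate: preliminaries for the assembly of Gilbarg–Trudinger Thm. 17.14

Bricks for `Literature/Analysis/PDE/EvansKrylovInterior.lean` (the abstract interior `C^{2,α}`
a-priori estimate for concave fully nonlinear equations in coordinate-jet form); everything here
is proved:

* `exists_ek_directions` — **the Evans–Krylov direction set**: the Motzkin–Wasow directions of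
  the class `S[λ, Λ]` (`exists_motzkinWasow_directions`, GT Lemma 17.13) chosen to CONTAIN the
  coordinate directions `e_i` and the diagonals `(e_i ± e_j)/√2`, `i ≠ j` (the "last assertion of
  Lemma 17.13"), packaged with the decomposition `A = Σ β_k γ_k ⊗ γ_k`, `λ* ≤ β_k ≤ Λ*`;
* `quadHess_eq_sum` — `D_{γγ}u(z) = Σ_{ij} γ_i γ_j H_{ij}(z)` with the Hessian matrix entries;
* `abs_quadHess_le` — `|D_{γγ}u(z)| ≤ n‖D²u(z)‖` for a unit coordinate vector `γ`;
* `contDiffOn_quadHess` — `D_{γγ}u` is `C²` on an open set on which `u` is `C⁴`;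
* `measurable_quadHess` — `D_{γγ}u` is Borel measurable (the derivative of any function is);
* `hessianMatrix_isSymm` — the Hessian matrix of a `C²` function is symmetric.

## References

* D. Gilbarg, N. S. Trudinger, *Elliptic Partial Differential Equations of Second Order* (2001),
  §17.4, Lemma 17.13 and the proof of Thm. 17.14. [GilbargTrudinger2001]
-/

noncomputable section

open Matrix Finset Metric Set

namespace Literature.Analysis.PDE.EvansKrylov

open Literature.Analysis.Calculus Literature.Analysis.PDE.ABP Literature.Analysis.PDE.KrylovSafonov

variable {ι : Type*} [Fintype ι] [DecidableEq ι]

/-! ### The Evans–Krylov direction set -/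

/-- The coordinate directions `e_i` and the diagonals `(e_i ± e_j)/√2` (`i ≠ j`) are unit
vectors: the prescribed family handed to the Motzkin–Wasow lemma. [folklore] -/
theorem exists_ek_extra (ι : Type*) [Fintype ι] [DecidableEq ι] :
    ∃ (M : ℕ) (extra : Fin M → ι → ℝ), (∀ k, extra k ⬝ᵥ extra k = 1) ∧
      (∀ i, ∃ k, extra k = Pi.single i 1) ∧
      (∀ i j, i ≠ j →
        (∃ k, extra k = (Real.sqrt 2)⁻¹ • (Pi.single i 1 + Pi.single j 1)) ∧
        (∃ k, extra k = (Real.sqrt 2)⁻¹ • (Pi.single i 1 - Pi.single j 1))) := by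
  classical
  -- index type `ι ⊕ (ι × ι) ⊕ (ι × ι)` and the vectors
  set vec : ι ⊕ (ι × ι) ⊕ (ι × ι) → ι → ℝ := fun x ↦
    match x with
    | Sum.inl i => Pi.single i 1
    | Sum.inr (Sum.inl p) =>
        if p.1 = p.2 then Pi.single p.1 1
        else (Real.sqrt 2)⁻¹ • (Pi.single p.1 1 + Pi.single p.2 1)
    | Sum.inr (Sum.inr p) =>
        if p.1 = p.2 then Pi.single p.1 1
        else (Real.sqrt 2)⁻¹ • (Pi.single p.1 1 - Pi.single p.2 1) with hvec
  have h2 : (Real.sqrt 2)⁻¹ * (Real.sqrt 2)⁻¹ = 1 / 2 := by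
    rw [← mul_inv, Real.mul_self_sqrt (by norm_num : (0:ℝ) ≤ 2), one_div]
  have hunit_single : ∀ i : ι, (Pi.single i (1:ℝ) : ι → ℝ) ⬝ᵥ Pi.single i 1 = 1 := fun i ↦ by
    simp
  have hab : ∀ i j : ι, i ≠ j → (Pi.single i (1:ℝ) : ι → ℝ) ⬝ᵥ Pi.single j 1 = 0 :=
    fun i j hij ↦ by simp [hij]
  have hunit_plus : ∀ i j : ι, i ≠ j →
      ((Real.sqrt 2)⁻¹ • (Pi.single i 1 + Pi.single j 1) : ι → ℝ) ⬝ᵥ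
        ((Real.sqrt 2)⁻¹ • (Pi.single i 1 + Pi.single j 1)) = 1 := fun i j hij ↦ by
    rw [smul_dotProduct, dotProduct_smul, add_dotProduct, dotProduct_add, dotProduct_add,
      hunit_single, hunit_single, hab i j hij, hab j i (Ne.symm hij), smul_eq_mul, smul_eq_mul]
    linear_combination (2:ℝ) * h2
  have hunit_minus : ∀ i j : ι, i ≠ j →
      ((Real.sqrt 2)⁻¹ • (Pi.single i 1 - Pi.single j 1) : ι → ℝ) ⬝ᵥ
        ((Real.sqrt 2)⁻¹ • (Pi.single i 1 - Pi.single j 1)) = 1 := fun i j hij ↦ by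
    rw [smul_dotProduct, dotProduct_smul, sub_dotProduct, dotProduct_sub, dotProduct_sub,
      hunit_single, hunit_single, hab i j hij, hab j i (Ne.symm hij), smul_eq_mul, smul_eq_mul]
    linear_combination (2:ℝ) * h2
  have hvunit : ∀ x, vec x ⬝ᵥ vec x = 1 := by
    rintro (i | ⟨i, j⟩ | ⟨i, j⟩)
    · exact hunit_single i
    · by_cases hij : i = j
      · simp only [hvec, hij, if_true]; exact hunit_single j
      · simp only [hvec, hij, if_false]; exact hunit_plus i j hij
    · by_cases hij : i = j
      · simp only [hvec, hij, if_true]; exact hunit_single j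
      · simp only [hvec, hij, if_false]; exact hunit_minus i j hij
  set e := Fintype.equivFin (ι ⊕ (ι × ι) ⊕ (ι × ι)) with he
  refine ⟨_, fun k ↦ vec (e.symm k), fun k ↦ hvunit _, fun i ↦ ⟨e (Sum.inl i), ?_⟩,
    fun i j hij ↦ ⟨⟨e (Sum.inr (Sum.inl (i, j))), ?_⟩, ⟨e (Sum.inr (Sum.inr (i, j))), ?_⟩⟩⟩
  · simp only [Equiv.symm_apply_apply, hvec]
  · simp only [Equiv.symm_apply_apply, hvec, hij, if_false]
  · simp only [Equiv.symm_apply_apply, hvec, hij, if_false]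

/-- **The Evans–Krylov direction set** (Gilbarg–Trudinger Lemma 17.13 in full): for `0 < λ ≤ Λ`
there are finitely many unit coordinate vectors `γ_1, …, γ_N` — among them every `e_i` and every
`(e_i ± e_j)/√2`, `i ≠ j` — and constants `0 < λ* ≤ Λ*`, depending only on `n, λ, Λ`, such that
every symmetric `A` with `λ|ξ|² ≤ ξᵀAξ ≤ Λ|ξ|²` is `Σ_k β_k γ_k ⊗ γ_k` with `λ* ≤ β_k ≤ Λ*`.
[cite: GilbargTrudinger2001, Lemma 17.13] -/
theorem exists_ek_directions (ι : Type*) [Fintype ι] [DecidableEq ι] [Nonempty ι]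
    {lam Λ : ℝ} (hlam : 0 < lam) (hΛ : lam ≤ Λ) :
    ∃ (N : ℕ) (γ : Fin N → ι → ℝ) (lamS ΛS : ℝ), 0 < lamS ∧ lamS ≤ ΛS ∧
      (∀ k, γ k ⬝ᵥ γ k = 1) ∧ (∀ i, ∃ k, γ k = Pi.single i 1) ∧
      (∀ i j, i ≠ j →
        (∃ k, γ k = (Real.sqrt 2)⁻¹ • (Pi.single i 1 + Pi.single j 1)) ∧
        (∃ k, γ k = (Real.sqrt 2)⁻¹ • (Pi.single i 1 - Pi.single j 1))) ∧
      ∀ A : Matrix ι ι ℝ, A.IsSymm →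
        (∀ ξ : ι → ℝ, lam * (ξ ⬝ᵥ ξ) ≤ ξ ⬝ᵥ (A *ᵥ ξ)) →
        (∀ ξ : ι → ℝ, ξ ⬝ᵥ (A *ᵥ ξ) ≤ Λ * (ξ ⬝ᵥ ξ)) →
        ∃ β : Fin N → ℝ, (∀ k, lamS ≤ β k ∧ β k ≤ ΛS) ∧
          A = ∑ k, β k • vecMulVec (γ k) (γ k) := by
  obtain ⟨M, extra, hunit, hdiag, hoff⟩ := exists_ek_extra ι
  obtain ⟨N, γ, lamS, ΛS, hlamS, hle, hγ, hγextra, hrep⟩ :=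
    exists_motzkinWasow_directions ι hlam hΛ extra hunit
  refine ⟨N, γ, lamS, ΛS, hlamS, hle, hγ, fun i ↦ ?_, fun i j hij ↦ ⟨?_, ?_⟩, hrep⟩
  · obtain ⟨k, hk⟩ := hdiag i
    obtain ⟨j, hj⟩ := hγextra k
    exact ⟨j, hj.trans hk⟩
  · obtain ⟨k, hk⟩ := (hoff i j hij).1
    obtain ⟨l, hl⟩ := hγextra k
    exact ⟨l, hl.trans hk⟩
  · obtain ⟨k, hk⟩ := (hoff i j hij).2
    obtain ⟨l, hl⟩ := hγextra k
    exact ⟨l, hl.trans hk⟩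

/-! ### The pure second derivatives `quadHess` -/

/-- `D_{γγ}u(z) = Σ_i γ_i Σ_j H_{ij}(z) γ_j` with `H = hessianMatrix u e z`. [folklore] -/
theorem quadHess_eq_sum (u : EuclideanSpace ℝ ι → ℝ) (γ : ι → ℝ) (z : EuclideanSpace ℝ ι) :
    quadHess u γ z =
      ∑ i, γ i * ∑ j, hessianMatrix u (EuclideanSpace.basisFun ι ℝ) z i j * γ j := by
  simp [quadHess, dotProduct, Matrix.mulVec]

/-- The Hessian matrix entries are bounded by the operator norm of `D²u`. [folklore] -/
theorem abs_hessianMatrix_le (u : EuclideanSpace ℝ ι → ℝ) (z : EuclideanSpace ℝ ι) (i j : ι) :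
    |hessianMatrix u (EuclideanSpace.basisFun ι ℝ) z i j| ≤ ‖iteratedFDeriv ℝ 2 u z‖ := by
  rw [hessianMatrix_eq_cjetOf]
  exact abs_cjetOf_le (EuclideanSpace.basisFun ι ℝ) 2 u z (Fin.last 2) ![i, j]

/-- **`|D_{γγ}u(z)| ≤ n ‖D²u(z)‖` for a unit coordinate vector `γ`** (entrywise bound and
`(Σ|γ_i|)² ≤ n Σγ_i²`). [folklore] -/
theorem abs_quadHess_le (u : EuclideanSpace ℝ ι → ℝ) {γ : ι → ℝ} (hγ : γ ⬝ᵥ γ = 1)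
    (z : EuclideanSpace ℝ ι) :
    |quadHess u γ z| ≤ Fintype.card ι * ‖iteratedFDeriv ℝ 2 u z‖ := by
  rw [quadHess_eq_sum]
  set Kz := ‖iteratedFDeriv ℝ 2 u z‖ with hKz
  have hK0 : 0 ≤ Kz := norm_nonneg _
  have h1 : |∑ i, γ i * ∑ j, hessianMatrix u (EuclideanSpace.basisFun ι ℝ) z i j * γ j| ≤
      ∑ i, |γ i| * ∑ j, Kz * |γ j| := by
    refine (Finset.abs_sum_le_sum_abs _ _).trans (Finset.sum_le_sum fun i _ ↦ ?_)
    rw [abs_mul]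
    refine mul_le_mul_of_nonneg_left ?_ (abs_nonneg _)
    refine (Finset.abs_sum_le_sum_abs _ _).trans (Finset.sum_le_sum fun j _ ↦ ?_)
    rw [abs_mul]
    exact mul_le_mul_of_nonneg_right (abs_hessianMatrix_le u z i j) (abs_nonneg _)
  have h2 : ∑ i, |γ i| * ∑ j, Kz * |γ j| = Kz * (∑ i, |γ i|) ^ 2 := by
    rw [← Finset.mul_sum, ← Finset.sum_mul]
    ring
  have h3 : (∑ i, |γ i|) ^ 2 ≤ Fintype.card ι * ∑ i, |γ i| ^ 2 := by
    have := sq_sum_le_card_mul_sum_sq (s := Finset.univ) (f := fun i ↦ |γ i|)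
    simpa using this
  have h4 : ∑ i, |γ i| ^ 2 = 1 := by
    rw [← hγ, dotProduct]
    exact Finset.sum_congr rfl fun i _ ↦ by rw [sq_abs, sq]
  rw [h4, mul_one] at h3
  calc |∑ i, γ i * ∑ j, hessianMatrix u (EuclideanSpace.basisFun ι ℝ) z i j * γ j|
      ≤ Kz * (∑ i, |γ i|) ^ 2 := h1.trans_eq h2
    _ ≤ Kz * Fintype.card ι := mul_le_mul_of_nonneg_left h3 hK0
    _ = Fintype.card ι * Kz := mul_comm _ _

omit [DecidableEq ι] in
/-- A Hessian matrix entry `z ↦ D²u(z)(e_i, e_j)` is `C²` on an open set where `u` is `C⁴`.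
[folklore] -/
theorem contDiffOn_hessianMatrix_apply {u : EuclideanSpace ℝ ι → ℝ} {O : Set (EuclideanSpace ℝ ι)}
    (hO : IsOpen O) (hu : ContDiffOn ℝ 4 u O) (i j : ι) :
    ContDiffOn ℝ 2 (fun z ↦ hessianMatrix u (EuclideanSpace.basisFun ι ℝ) z i j) O := by
  have heq : (fun z ↦ hessianMatrix u (EuclideanSpace.basisFun ι ℝ) z i j) = fun z ↦
      iteratedFDeriv ℝ 2 u z ![EuclideanSpace.basisFun ι ℝ i, EuclideanSpace.basisFun ι ℝ j] := by
    funext z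
    rw [hessianMatrix_apply, iteratedFDeriv_two_apply]
    rfl
  rw [heq]
  intro z hz
  have huz : ContDiffAt ℝ 4 u z := hu.contDiffAt (hO.mem_nhds hz)
  have h1 : ContDiffAt ℝ 2 (iteratedFDeriv ℝ 2 u) z :=
    huz.iteratedFDeriv_right (m := 2) (i := 2) (by norm_num)
  exact ((ContinuousMultilinearMap.apply ℝ (fun _ : Fin 2 ↦ EuclideanSpace ℝ ι) ℝ
    ![EuclideanSpace.basisFun ι ℝ i, EuclideanSpace.basisFun ι ℝ j]).contDiff.contDiffAt.comp z
      h1).contDiffWithinAt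

/-- **`D_{γγ}u` is `C²`** on an open set on which `u` is `C⁴`. [folklore] -/
theorem contDiffOn_quadHess {u : EuclideanSpace ℝ ι → ℝ} {O : Set (EuclideanSpace ℝ ι)}
    (hO : IsOpen O) (hu : ContDiffOn ℝ 4 u O) (γ : ι → ℝ) :
    ContDiffOn ℝ 2 (quadHess u γ) O := by
  have heq : quadHess u γ = fun z ↦
      ∑ i, γ i * ∑ j, hessianMatrix u (EuclideanSpace.basisFun ι ℝ) z i j * γ j :=
    funext fun z ↦ quadHess_eq_sum u γ z
  rw [heq]
  refine ContDiffOn.sum fun i _ ↦ contDiffOn_const.mul (ContDiffOn.sum fun j _ ↦ ?_)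
  exact (contDiffOn_hessianMatrix_apply hO hu i j).mul contDiffOn_const

/-- A Hessian matrix entry `z ↦ D²u(z)(e_i, e_j)` is Borel measurable, for ANY `u` (the
derivative of any function is measurable, `measurable_fderiv`). [folklore] -/
theorem measurable_hessianMatrix_apply (u : EuclideanSpace ℝ ι → ℝ) (i j : ι) :
    Measurable fun z ↦ hessianMatrix u (EuclideanSpace.basisFun ι ℝ) z i j := by
  have h1 : Measurable fun z ↦ fderiv ℝ (fderiv ℝ u) z (EuclideanSpace.basisFun ι ℝ i) :=
    measurable_fderiv_apply_const ℝ (fderiv ℝ u) _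
  have h2 : Measurable fun z ↦
      fderiv ℝ (fderiv ℝ u) z (EuclideanSpace.basisFun ι ℝ i) (EuclideanSpace.basisFun ι ℝ j) :=
    (ContinuousLinearMap.measurable_apply (EuclideanSpace.basisFun ι ℝ j)).comp h1
  simpa [hessianMatrix_apply] using h2

/-- **`D_{γγ}u` is Borel measurable**, for any `u`. [folklore] -/
theorem measurable_quadHess (u : EuclideanSpace ℝ ι → ℝ) (γ : ι → ℝ) :
    Measurable (quadHess u γ) := by
  have heq : quadHess u γ = fun z ↦
      ∑ i, γ i * ∑ j, hessianMatrix u (EuclideanSpace.basisFun ι ℝ) z i j * γ j :=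
    funext fun z ↦ quadHess_eq_sum u γ z
  rw [heq]
  refine Finset.measurable_sum _ fun i _ ↦ Measurable.const_mul ?_ _
  refine Finset.measurable_sum _ fun j _ ↦ ?_
  exact (measurable_hessianMatrix_apply u i j).mul_const _

omit [DecidableEq ι] in
/-- **The Hessian matrix of a `C²` function is symmetric.** [folklore] -/
theorem hessianMatrix_isSymm {u : EuclideanSpace ℝ ι → ℝ} {z : EuclideanSpace ℝ ι}
    (hu : ContDiffAt ℝ 2 u z) : (hessianMatrix u (EuclideanSpace.basisFun ι ℝ) z).IsSymm := by
  have hs : IsSymmSndFDerivAt ℝ u z := hu.isSymmSndFDerivAt (by simp)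
  ext i j
  simp only [transpose_apply, hessianMatrix_apply]
  exact hs _ _

end Literature.Analysis.PDE.EvansKrylov

end
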